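import Mathlib

/-!
# Stub `stub_graphBounds` of line `Sketch` (skeleton v6) for crux `TameOrBrodyR4` (stmt-SmoothPoincare4-7826, route SullivanDual)

Point-set bookkeeping for the graph functions `g b` of a pencil of planes in `ℝ⁴`. The pencil is
given by an injective, continuous evaluation map `F : ℂ → ℂ → ℝ⁴` (`F b` parametrises the member
asymptotic to the coordinate line `{Q = b}`) together with two coordinate maps `P Q : ℝ⁴ →L[ℝ] ℂ`;
`g b c` is the `Q`-value of the member `b` over the point `c` of the `P`-line (`hg`). We prove:

* (i) slab bound: a member with `‖b‖ < R` never reaches the region `{R ≤ ‖Q‖}` — that region is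
  filled by the far members (`hF5'`), and those are different members (injectivity `hF2`); hence
  `‖g b c‖ < R` whenever `R ≤ ‖c‖`;
* (ii) honesty: `g b c = b` for far `b` (`hF5`);
* (iii) `g b c → b` as `c → ∞`: given `ε > 0`, `hF9` yields a compact `S ⊆ ℂ` off which
  `Q (F b ξ)` is `ε`-close to `b`; for `c` outside the compact set
  `closedBall 0 |R| ∪ (ξ ↦ P (F b ξ)) '' S` the crossing parameter `ξ` with `P (F b ξ) = c`
  (`hF6`) lies outside `S`, so `dist (g b c) b = dist (Q (F b ξ)) b < ε`.

Source: M. Gromov, Invent. Math. 82 (1985) §2.4.A (pencils of `J`-planes; here only the point-set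
bookkeeping). Mathlib only (`Filter.mem_cocompact`, `Metric.tendsto_nhds`, `IsCompact.image`,
`isCompact_closedBall`, `IsCompact.union`).
-/

open scoped Topology
open Filter Set Function

-- the registered namespace `Summit.SmoothPoincare4.SmoothPoincare4.…` repeats a component
set_option linter.dupNamespace false

noncomputable section

namespace Summit.SmoothPoincare4.SmoothPoincare4.Cruxes.TameOrBrodyR4.Sketch

/-- Local notation for the model space `ℝ⁴ = EuclideanSpace ℝ (Fin 4)`. -/
local notation "E4" => EuclideanSpace ℝ (Fin 4)

namespace GraphBounds

/-- Over a far point `c` (`R ≤ ‖c‖`) the member `b` has a crossing parameter `ξ` with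
`P (F b ξ) = c`, and the graph value `g b c` is the `Q`-coordinate `Q (F b ξ)` of that crossing. -/
theorem exists_crossing (R : ℝ) (P Q : E4 →L[ℝ] ℂ) (F : ℂ → ℂ → E4) (g : ℂ → ℂ → ℂ)
    (hF6 : ∀ b c : ℂ, R ≤ ‖c‖ → ∃ ξ, P (F b ξ) = c)
    (hg : ∀ b ξ : ℂ, R ≤ ‖P (F b ξ)‖ → g b (P (F b ξ)) = Q (F b ξ))
    (b c : ℂ) (hc : R ≤ ‖c‖) : ∃ ξ, P (F b ξ) = c ∧ g b c = Q (F b ξ) := by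
  obtain ⟨ξ, hξ⟩ := hF6 b c hc
  refine ⟨ξ, hξ, ?_⟩
  rw [← hξ]
  exact hg b ξ (by rw [hξ]; exact hc)

end GraphBounds

/-- **Stub C2c (graph bounds).** For a pencil of planes in `ℝ⁴` given by a continuous injective
evaluation map `F : ℂ → ℂ → ℝ⁴` whose far members (`R ≤ ‖b‖`) lie in and fill the coordinate lines
`{Q = b}` (`hF5`, `hF5'`), whose members cross every far line `{P = c}` (`hF6`) and satisfy
`Q (F b ξ) → b` as `ξ → ∞` (`hF9`), the graph functions `g b` (`hg`) satisfy: (i) the slab bound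
`‖g b c‖ < R` for `‖b‖ < R ≤ ‖c‖`; (ii) honesty `g b c = b` for `R ≤ ‖b‖`, `R ≤ ‖c‖`;
(iii) `g b c → b` as `c → ∞`. -/
theorem stub_graphBounds (R : ℝ) (P Q : E4 →L[ℝ] ℂ) (F : ℂ → ℂ → E4) (g : ℂ → ℂ → ℂ)
    (hF1 : Continuous (fun p : ℂ × ℂ => F p.1 p.2))
    (hF2 : Function.Injective (fun p : ℂ × ℂ => F p.1 p.2))
    (hF5 : ∀ b : ℂ, R ≤ ‖b‖ → ∀ ξ, Q (F b ξ) = b)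
    (hF5' : ∀ x : E4, R ≤ ‖Q x‖ → ∃ ξ, F (Q x) ξ = x)
    (hF6 : ∀ b c : ℂ, R ≤ ‖c‖ → ∃ ξ, P (F b ξ) = c)
    (hF9 : ∀ b, Tendsto (fun ξ => Q (F b ξ)) (cocompact ℂ) (𝓝 b))
    (hg : ∀ b ξ : ℂ, R ≤ ‖P (F b ξ)‖ → g b (P (F b ξ)) = Q (F b ξ)) :
    (∀ b c : ℂ, ‖b‖ < R → R ≤ ‖c‖ → ‖g b c‖ < R) ∧
      (∀ b c : ℂ, R ≤ ‖b‖ → R ≤ ‖c‖ → g b c = b) ∧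
      (∀ b, Tendsto (g b) (cocompact ℂ) (𝓝 b)) := by
  refine ⟨fun b c hb hc => ?_, fun b c hb hc => ?_, fun b => ?_⟩
  · -- (i) slab bound: the crossing point cannot lie in the far region, which belongs to far members
    obtain ⟨ξ, -, hgc⟩ := GraphBounds.exists_crossing R P Q F g hF6 hg b c hc
    rw [hgc]
    refine not_le.1 fun h => ?_
    obtain ⟨ξ', hξ'⟩ := hF5' (F b ξ) h
    have hpair : (Q (F b ξ), ξ') = (b, ξ) := hF2 (a₁ := (Q (F b ξ), ξ')) (a₂ := (b, ξ)) hξ'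
    have hbq : Q (F b ξ) = b := congrArg Prod.fst hpair
    rw [hbq] at h
    exact (not_le.2 hb) h
  · -- (ii) honesty of far members
    obtain ⟨ξ, -, hgc⟩ := GraphBounds.exists_crossing R P Q F g hF6 hg b c hc
    rw [hgc, hF5 b hb ξ]
  · -- (iii) the crossing parameter leaves every compact set as `c → ∞`
    have hPc : Continuous fun ξ : ℂ => P (F b ξ) :=
      P.continuous.comp (hF1.comp (Continuous.prodMk_right b))
    refine Metric.tendsto_nhds.2 fun ε hε => ?_
    obtain ⟨S, hS, hSsub⟩ := mem_cocompact.1 (Metric.tendsto_nhds.1 (hF9 b) ε hε)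
    refine mem_cocompact.2 ⟨Metric.closedBall (0 : ℂ) |R| ∪ (fun ξ => P (F b ξ)) '' S,
      (isCompact_closedBall (0 : ℂ) |R|).union (hS.image hPc), fun c hc => ?_⟩
    have hcR : |R| < ‖c‖ := not_le.1 fun h => hc (Or.inl (mem_closedBall_zero_iff.2 h))
    have hc' : R ≤ ‖c‖ := (le_abs_self R).trans hcR.le
    obtain ⟨ξ, hξ, hgc⟩ := GraphBounds.exists_crossing R P Q F g hF6 hg b c hc'
    have hξS : ξ ∉ S := fun h => hc (Or.inr ⟨ξ, h, hξ⟩)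
    have hlt : dist (Q (F b ξ)) b < ε := hSsub hξS
    show dist (g b c) b < ε
    rwa [hgc]

end Summit.SmoothPoincare4.SmoothPoincare4.Cruxes.TameOrBrodyR4.Sketch
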